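import Literature.Analysis.FunctionSpaces.PolchinskiExchangeJets
import Literature.Analysis.FunctionSpaces.PolchinskiExchangeSlope
import Literature.Analysis.FunctionSpaces.PolchinskiSemigroupJets
import Literature.Analysis.FunctionSpaces.PolchinskiDualGeneratorFamily
import Literature.Analysis.FunctionSpaces.PolchinskiEquation
import HarnessLib

/-!
# The exchange inequality `d/dt E_{ν_t}[(∇√P_{0,t}F)²_{Ċ_t}] ≤ −2λ̇_t E_{ν_t}[(∇√P_{0,t}F)²_{Ċ_t}]`
# (Bauerschmidt–Bodineau–Dagallier, proof of Theorem 3: Lemma 1 + (e:assCt-mon), integrated against `ν_t`)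

Topic `Literature/Analysis/FunctionSpaces`; "proof architecture" file behind the named fact
`Polchinski.BauerschmidtBodineau_multiscaleBakryEmery` ([BBD] Theorem 3, `MultiscaleBakryEmery.lean`).

[BBD] prove Theorem 3 (p0016) by showing that `ψ(t) = e^{2λ_t}E_{ν_t}[(∇√P_{0,t}F)²_{Ċ_t}]`-type quantities
decrease: by the dual identity `d/dt E_{ν_t}[G_t] = −E_{ν_t}[(L_t − ∂_t)G_t]` and Lemma 1 (the Bochner formula
for `(L_t − ∂_t)(∇√P_{0,t}F)²_{Ċ_t}`), the multiscale condition (e:assCt-mon) gives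
`d/dt E_{ν_t}[(∇√P_{0,t}F)²_{Ċ_t}] ≤ −2λ̇_t E_{ν_t}[(∇√P_{0,t}F)²_{Ċ_t}]` (p0016 L130–153).  This file proves
exactly this differential inequality, for `V₀ ∈ C⁴` and `F ∈ C⁴` with bounded derivatives and
`0 < a ≤ F ≤ b` (so that `P_{0,t}F = W_t/Z_t` has three bounded derivatives and `P_{0,t}F ≥ a`), assembling:
the smoothed atoms (`PolchinskiSemigroupJets.lean`), the spatial jets and the pointwise inequality
(`PolchinskiExchangeJets.lean`), the time slopes (`PolchinskiExchangeSlope.lean`), the multiscale condition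
in jet form (below, from `hasFDerivAt_fderiv_renormPotential`), and the dual family identity
(`hasDerivAt_renormExpect_family`).  Here `(∇√u)²_{Ċ} = Σ Ċ^{kl}∂_ku ∂_lu/(4u)` with `u = P_{0,t}F`,
`∂_k u = fderiv (P_{0,t}F) e_k`, and `Ċ_t` is read at `max t 0` so that the family is defined and bounded for
all real `t` (it is used at `t > 0` only).

## Main results (sorry-free; no new definitions, no new named facts)

* `renormExpect_mono`, `renormExpect_const_mul` — order and linearity of `E_{ν_t}`;
* `sqrtEnergy_nonneg` — `(∇√P_{0,s}F)²_{Ċ_{s∨0}} ≥ 0`;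
* **`hasDerivAt_renormExpect_sqrtEnergy_le`** — for `t > 0`:
  `k(s) = E_{ν_s}[(∇√P_{0,s}F)²_{Ċ_s}]` is differentiable at `t` with `k'(t) ≤ −2λ̇_t k(t)`.

Nothing here concerns Yang–Mills; this is one step of [BBD] Theorem 3 for a class of smooth potentials.

## References

* [BauerschmidtBodineauDagallier2023] R. Bauerschmidt, T. Bodineau, B. Dagallier, Probab. Surveys 21
  (2024) 200–290, arXiv:2307.07619 — Theorem 3 proof p0016 L47–153, Lemma 1 p0016–p0017. READ (held text).
-/

noncomputable section

-- nested operator-norm instances `E →L[ℝ] E →L[ℝ] ℝ`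
set_option maxSynthPendingDepth 3

open MeasureTheory ProbabilityTheory Filter Topology Set
open scoped RealInnerProductSpace Matrix MatrixOrder

namespace Literature.Analysis.FunctionSpaces

namespace Polchinski

variable {N : ℕ}

/-! ### Helpers -/

section Helpers

/-- `⟪g, Ċ h⟫ = g·(Ċh)` between `EuclideanSpace` and `Fin N → ℝ`. [folklore] -/
private theorem inner_toEuclideanLin (C : Matrix (Fin N) (Fin N) ℝ) (g h : Fin N → ℝ) :
    ⟪WithLp.toLp 2 g, Matrix.toEuclideanLin C (WithLp.toLp 2 h)⟫ = g ⬝ᵥ (C *ᵥ h) := by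
  rw [EuclideanSpace.inner_eq_star_dotProduct, star_trivial, dotProduct_comm]
  rfl

/-- A continuous bilinear form in coordinates: `B u w = Σ_{ik} u_i w_k B(e_i, e_k)`. [folklore] -/
private theorem bilin_apply_eq_sum
    (B : EuclideanSpace ℝ (Fin N) →L[ℝ] EuclideanSpace ℝ (Fin N) →L[ℝ] ℝ)
    (u w : EuclideanSpace ℝ (Fin N)) :
    B u w = ∑ i, ∑ k, (u i * w k) * B (EuclideanSpace.single i 1) (EuclideanSpace.single k 1) := by
  have hu : u = ∑ i, u i • EuclideanSpace.single i (1 : ℝ) := by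
    simpa [EuclideanSpace.basisFun_apply] using ((EuclideanSpace.basisFun (Fin N) ℝ).sum_repr u).symm
  have hw : w = ∑ k, w k • EuclideanSpace.single k (1 : ℝ) := by
    simpa [EuclideanSpace.basisFun_apply] using ((EuclideanSpace.basisFun (Fin N) ℝ).sum_repr w).symm
  conv_lhs => rw [hu, hw]
  simp only [map_sum, map_smul, _root_.sum_apply, _root_.smul_apply, smul_eq_mul, Finset.mul_sum]
  rw [Finset.sum_comm]
  refine Finset.sum_congr rfl fun i _ => Finset.sum_congr rfl fun k _ => ?_
  ring

/-- `Hess f(φ)(u,u)` as the second Fréchet derivative. [folklore] -/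
private theorem hessQF_eq (f : EuclideanSpace ℝ (Fin N) → ℝ) (φ u : EuclideanSpace ℝ (Fin N)) :
    hessQF f φ u = fderiv ℝ (fderiv ℝ f) φ u u := by
  simp only [hessQF, iteratedFDeriv_two_apply, Matrix.cons_val_zero, Matrix.cons_val_one]

/-- Bounded functions: products, sums. [folklore] -/
private theorem bd_mul {α : Type*} {f g : α → ℝ} (hf : ∃ A, ∀ y, |f y| ≤ A) (hg : ∃ B, ∀ y, |g y| ≤ B) :
    ∃ K, ∀ y, |f y * g y| ≤ K := by
  obtain ⟨A, hA⟩ := hf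
  obtain ⟨B, hB⟩ := hg
  refine ⟨A * B, fun y => ?_⟩
  rw [abs_mul]
  exact mul_le_mul (hA y) (hB y) (abs_nonneg _) ((abs_nonneg _).trans (hA y))

/-- Bounded functions: differences. [folklore] -/
private theorem bd_sub {α : Type*} {f g : α → ℝ} (hf : ∃ A, ∀ y, |f y| ≤ A) (hg : ∃ B, ∀ y, |g y| ≤ B) :
    ∃ K, ∀ y, |f y - g y| ≤ K := by
  obtain ⟨A, hA⟩ := hf
  obtain ⟨B, hB⟩ := hg
  exact ⟨A + B, fun y => (abs_sub _ _).trans (add_le_add (hA y) (hB y))⟩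

/-- Bounded functions: finite sums. [folklore] -/
private theorem bd_sum {α ι : Type*} (S : Finset ι) {F : ι → α → ℝ}
    (h : ∀ i ∈ S, ∃ K, ∀ y, |F i y| ≤ K) : ∃ K, ∀ y, |∑ i ∈ S, F i y| ≤ K := by
  classical
  choose! K hK using h
  exact ⟨∑ i ∈ S, K i, fun y =>
    (Finset.abs_sum_le_sum_abs _ _).trans (Finset.sum_le_sum fun i hi => hK i hi y)⟩

/-- The `C_b²` pack of a smoothed partial along a basis vector, with `‖e_k‖ = 1` substituted.
[cite: BauerschmidtBodineauDagallier2023, Theorem 3 (proof)] -/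
private theorem partial_pack_single {Ψ : EuclideanSpace ℝ (Fin N) → ℝ} {B : ℝ} (hΨ : ContDiff ℝ 4 Ψ)
    (hB : ∀ n ≤ 4, ∀ x, ‖iteratedFDeriv ℝ n Ψ x‖ ≤ B)
    (P : Measure (EuclideanSpace ℝ (Fin N))) [IsProbabilityMeasure P] (k : Fin N) :
    (∀ y, HasFDerivAt (fun y => ∫ ζ, fderiv ℝ Ψ (y + ζ) (EuclideanSpace.single k 1) ∂P)
      (∫ ζ, fderiv ℝ (fderiv ℝ Ψ) (y + ζ) (EuclideanSpace.single k 1) ∂P) y) ∧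
    (∀ y, HasFDerivAt (fun y => ∫ ζ, fderiv ℝ (fderiv ℝ Ψ) (y + ζ) (EuclideanSpace.single k 1) ∂P)
      (∫ ζ, fderiv ℝ (fderiv ℝ (fderiv ℝ Ψ)) (y + ζ) (EuclideanSpace.single k 1) ∂P) y) ∧
    (∀ y, |∫ ζ, fderiv ℝ Ψ (y + ζ) (EuclideanSpace.single k 1) ∂P| ≤ B) ∧
    (∀ y, ‖∫ ζ, fderiv ℝ (fderiv ℝ Ψ) (y + ζ) (EuclideanSpace.single k 1) ∂P‖ ≤ B) ∧
    (∀ y, ‖∫ ζ, fderiv ℝ (fderiv ℝ (fderiv ℝ Ψ)) (y + ζ) (EuclideanSpace.single k 1) ∂P‖ ≤ B) ∧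
    UniformContinuous (fun y => ∫ ζ, fderiv ℝ (fderiv ℝ (fderiv ℝ Ψ)) (y + ζ)
      (EuclideanSpace.single k 1) ∂P) := by
  have h := sm_partial_pack hΨ hB P (EuclideanSpace.single k 1)
  simp only [Cb4.norm_single_one, mul_one] at h
  exact h

end Helpers

/-! ### Order and linearity of `E_{ν_t}` -/

section Expect

variable (D : CovDecomposition N) {V₀ : EuclideanSpace ℝ (Fin N) → ℝ}

/-- **Monotonicity of `E_{ν_t}`** on bounded continuous functions (`ν_t` is a positive measure).
[cite: BauerschmidtBodineauDagallier2023, Definition 2] -/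
theorem renormExpect_mono (hV : Measurable V₀) {b : ℝ} (hb : ∀ φ, b ≤ V₀ φ) (t : ℝ)
    {f g : EuclideanSpace ℝ (Fin N) → ℝ} (hf : Continuous f) (hg : Continuous g)
    (hfb : ∃ K, ∀ x, |f x| ≤ K) (hgb : ∃ K, ∀ x, |g x| ≤ K) (hle : ∀ x, f x ≤ g x) :
    renormExpect D V₀ t f ≤ renormExpect D V₀ t g := by
  obtain ⟨Kf, hKf⟩ := hfb
  obtain ⟨Kg, hKg⟩ := hgb
  unfold renormExpect
  refine mul_le_mul_of_nonneg_left ?_ (Real.exp_pos _).le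
  have hi : ∀ {h : EuclideanSpace ℝ (Fin N) → ℝ} {K : ℝ}, Continuous h → (∀ x, |h x| ≤ K) →
      Integrable (fun ζ => Real.exp (-renormPotential D V₀ t ζ) * h ζ)
        (multivariateGaussian 0 (D.Cinf - D.C t)) := fun {h K} hc hK =>
    Integrable.of_bound (measurable_exp_neg_renormPotential_mul D hV t hc.measurable).aestronglyMeasurable
      (Real.exp (-b) * K) (Eventually.of_forall fun x => by
        rw [Real.norm_eq_abs]; exact abs_exp_neg_renormPotential_mul_le D hV hb t hK x)
  exact integral_mono (hi hf hKf) (hi hg hKg) fun ζ =>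
    mul_le_mul_of_nonneg_left (hle ζ) (Real.exp_pos _).le

/-- **Linearity of `E_{ν_t}` in constants**: `E_{ν_t}[c F] = c E_{ν_t}[F]`.
[cite: BauerschmidtBodineauDagallier2023, Definition 2] -/
theorem renormExpect_const_mul (t c : ℝ) (f : EuclideanSpace ℝ (Fin N) → ℝ) :
    renormExpect D V₀ t (fun x => c * f x) = c * renormExpect D V₀ t f := by
  unfold renormExpect
  have he : (fun ζ => Real.exp (-renormPotential D V₀ t ζ) * (c * f ζ)) =
      fun ζ => c * (Real.exp (-renormPotential D V₀ t ζ) * f ζ) := funext fun ζ => by ring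
  rw [he, integral_const_mul]
  ring

end Expect

/-! ### The multiscale condition in jet form -/

section Multiscale

variable (D : CovDecomposition N) {V₀ : EuclideanSpace ℝ (Fin N) → ℝ}
  {D1 : EuclideanSpace ℝ (Fin N) → EuclideanSpace ℝ (Fin N) →L[ℝ] ℝ}
  {D2 : EuclideanSpace ℝ (Fin N) → EuclideanSpace ℝ (Fin N) →L[ℝ] EuclideanSpace ℝ (Fin N) →L[ℝ] ℝ}

/-- **The multiscale condition (e:assCt-mon) at a point, in jet form**: for `g ∈ ℝ^N`,
`λ̇_t gᵀĊ_tg ≤ (Ċ_tg)ᵀ Hess V_t(x) (Ċ_tg) − ½ gᵀC̈_tg` with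
`Hess V_t(x)_{ik} = −E[∂_i∂_k e^{−V₀}(x+ζ)]/Z + E[∂_ie^{−V₀}]E[∂_ke^{−V₀}]/Z²`, `Z = E_{C_t}[e^{−V₀}(x+ζ)]`
(`V_t = −log Z`, `hasFDerivAt_fderiv_renormPotential`). [cite: BauerschmidtBodineauDagallier2023, Theorem 3 (e:assCt-mon)] -/
theorem multiscale_jet
    (hG1 : ∀ x, HasFDerivAt (fun x => Real.exp (-V₀ x)) (D1 x) x)
    (hG2 : ∀ x, HasFDerivAt D1 (D2 x) x) {b : ℝ} (hb : ∀ φ, b ≤ V₀ φ)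
    {K1 : ℝ} (hK1 : ∀ x, ‖D1 x‖ ≤ K1) {M : ℝ} (hM : ∀ x, ‖D2 x‖ ≤ M) (hD2c : Continuous D2)
    {lamdot : ℝ → ℝ} (hMS : MultiscaleCondition D V₀ lamdot) {t : ℝ} (ht : 0 < t)
    (x : EuclideanSpace ℝ (Fin N)) (g : Fin N → ℝ) :
    lamdot t * (g ⬝ᵥ (D.Cdot t *ᵥ g)) ≤
      (D.Cdot t *ᵥ g) ⬝ᵥ ((Matrix.of fun i k : Fin N =>
          -((∫ ζ, D2 (x + ζ) ∂(multivariateGaussian 0 (D.C t))) (EuclideanSpace.single i 1)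
              (EuclideanSpace.single k 1)) /
              (∫ ζ, Real.exp (-V₀ (x + ζ)) ∂(multivariateGaussian 0 (D.C t))) +
            (∫ ζ, D1 (x + ζ) ∂(multivariateGaussian 0 (D.C t))) (EuclideanSpace.single i 1) *
              (∫ ζ, D1 (x + ζ) ∂(multivariateGaussian 0 (D.C t))) (EuclideanSpace.single k 1) /
              (∫ ζ, Real.exp (-V₀ (x + ζ)) ∂(multivariateGaussian 0 (D.C t))) ^ 2) *ᵥ
          (D.Cdot t *ᵥ g)) -
        (1 / 2) * (g ⬝ᵥ (D.Cddot t *ᵥ g)) := by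
  set Z : ℝ := ∫ ζ, Real.exp (-V₀ (x + ζ)) ∂(multivariateGaussian 0 (D.C t)) with hZdef
  set DZ : EuclideanSpace ℝ (Fin N) →L[ℝ] ℝ := ∫ ζ, D1 (x + ζ) ∂(multivariateGaussian 0 (D.C t))
    with hDZdef
  set D2Z : EuclideanSpace ℝ (Fin N) →L[ℝ] EuclideanSpace ℝ (Fin N) →L[ℝ] ℝ :=
    ∫ ζ, D2 (x + ζ) ∂(multivariateGaussian 0 (D.C t)) with hD2Zdef
  set w : Fin N → ℝ := D.Cdot t *ᵥ g with hwdef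
  have h := hMS x t ht (WithLp.toLp 2 g)
  rw [inner_toEuclideanLin, inner_toEuclideanLin, hessQF_eq] at h
  have hf1 : fderiv ℝ (renormPotential D V₀ t) = fun ψ =>
      -((∫ ζ, Real.exp (-V₀ (ψ + ζ)) ∂(multivariateGaussian 0 (D.C t)))⁻¹ •
        ∫ ζ, D1 (ψ + ζ) ∂(multivariateGaussian 0 (D.C t))) :=
    funext fun ψ => (hasFDerivAt_renormPotential D hG1 hG2 hb hK1 t ψ).fderiv
  have hf2 := (hasFDerivAt_fderiv_renormPotential D hG1 hG2 hb hK1 hM hD2c t x).fderiv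
  rw [hf1, hf2, bilin_apply_eq_sum] at h
  have hw : ∀ i, (Matrix.toEuclideanLin (D.Cdot t) (WithLp.toLp 2 g)) i = w i := fun i => rfl
  simp only [hw] at h
  refine h.trans_eq ?_
  congr 1
  simp only [dotProduct, Matrix.mulVec, Matrix.of_apply, Finset.mul_sum]
  refine Finset.sum_congr rfl fun i _ => Finset.sum_congr rfl fun k _ => ?_
  simp only [_root_.neg_apply, _root_.add_apply, _root_.smul_apply,
    ContinuousLinearMap.smulRight_apply, smul_eq_mul]
  ring

end Multiscale

/-! ### The exchange inequality -/

section Exchange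

variable (D : CovDecomposition N) {V₀ F : EuclideanSpace ℝ (Fin N) → ℝ} {BV BF a b : ℝ}

/-- A linear combination `½ Σ_{ij} c_{ij} f_{ij}` of bounded uniformly continuous functions is bounded
(by `½ Σ|c_{ij}| B`) and uniformly continuous. [folklore] -/
private theorem uc_bdd_lincomb (c : Matrix (Fin N) (Fin N) ℝ)
    {f : Fin N → Fin N → EuclideanSpace ℝ (Fin N) → ℝ} {B : ℝ}
    (hf : ∀ i j, UniformContinuous (f i j)) (hb : ∀ i j y, |f i j y| ≤ B) :
    UniformContinuous (fun y => (1 / 2) * ∑ i, ∑ j, c i j * f i j y) ∧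
      ∀ y, |(1 / 2) * ∑ i, ∑ j, c i j * f i j y| ≤ (1 / 2) * (∑ i, ∑ j, |c i j|) * B := by
  classical
  refine ⟨?_, fun y => ?_⟩
  · refine uc_mul uniformContinuous_const (uc_finset_sum Finset.univ _ fun i _ =>
      uc_finset_sum Finset.univ _ fun j _ => uc_mul uniformContinuous_const (hf i j)
        (fun _ => le_rfl) (hb i j)) (A := |(1 / 2 : ℝ)|) (fun _ => le_rfl)
      (B := ∑ i, ∑ j, |c i j| * B) fun y => ?_
    exact (Finset.abs_sum_le_sum_abs _ _).trans (Finset.sum_le_sum fun i _ =>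
      (Finset.abs_sum_le_sum_abs _ _).trans (Finset.sum_le_sum fun j _ => by
        rw [abs_mul]; exact mul_le_mul_of_nonneg_left (hb i j y) (abs_nonneg _)))
  · rw [abs_mul, abs_of_pos (by norm_num : (0 : ℝ) < 1 / 2), mul_assoc, Finset.sum_mul]
    refine mul_le_mul_of_nonneg_left ?_ (by norm_num)
    refine (Finset.abs_sum_le_sum_abs _ _).trans (Finset.sum_le_sum fun i _ => ?_)
    rw [Finset.sum_mul]
    exact (Finset.abs_sum_le_sum_abs _ _).trans (Finset.sum_le_sum fun j _ => by
      rw [abs_mul]; exact mul_le_mul_of_nonneg_left (hb i j y) (abs_nonneg _))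

/-- **`(∇√P_{0,s}F)²_{Ċ_{s∨0}} ≥ 0`** (`Ċ ≥ 0`, `P_{0,s}F ≥ a > 0`).
[cite: BauerschmidtBodineauDagallier2023, Theorem 3 (proof)] -/
theorem sqrtEnergy_nonneg (hV : ContDiff ℝ 4 V₀) (hVB : ∀ n ≤ 4, ∀ x, ‖iteratedFDeriv ℝ n V₀ x‖ ≤ BV)
    (hF : ContDiff ℝ 4 F) (ha : 0 < a) (hab : ∀ x, a ≤ F x ∧ F x ≤ b) (s : ℝ)
    (y : EuclideanSpace ℝ (Fin N)) :
    0 ≤ (1 / 4) * ((∑ k, ∑ l, D.Cdot (max s 0) k l *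
        (fderiv ℝ (semigroup D V₀ 0 s F) y (EuclideanSpace.single k 1) *
          fderiv ℝ (semigroup D V₀ 0 s F) y (EuclideanSpace.single l 1))) *
        (semigroup D V₀ 0 s F y)⁻¹) := by
  have hA := sum_sum_mul_mul_self_nonneg (D.posSemidef_Cdot (max s 0) (le_max_right _ _))
    (fun k => fderiv ℝ (semigroup D V₀ 0 s F) y (EuclideanSpace.single k 1))
  have hVabs : ∀ x, |V₀ x| ≤ BV := Cb4.abs_le hVB
  have hu : 0 < semigroup D V₀ 0 s F y := by
    rw [semigroup_zero_eq]
    exact mul_pos (Real.exp_pos _) (lt_of_lt_of_le (by positivity)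
      (mul_exp_neg_le_integral_exp_neg_mul hV.continuous hVabs hF.continuous ha.le hab _ y))
  exact mul_nonneg (by norm_num) (mul_nonneg hA (inv_nonneg.2 hu.le))

set_option maxHeartbeats 1600000 in
/-- **The exchange inequality** ([BBD] proof of Theorem 3, p0016 L130–153: the dual identity, Lemma 1 and
the multiscale condition (e:assCt-mon)).  Let `V₀ ∈ C⁴(ℝ^N)` and `F ∈ C⁴(ℝ^N)` have bounded derivatives of
orders `≤ 4`, `0 < a ≤ F ≤ b`, and let (e:assCt-mon) hold with rates `λ̇`.  Then for every `t > 0` the function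
`k(s) = E_{ν_s}[(∇√P_{0,s}F)²_{Ċ_s}] = E_{ν_s}[Σ Ċ_s^{kl} ∂_kP_{0,s}F ∂_lP_{0,s}F /(4P_{0,s}F)]` is differentiable at
`t` and `k'(t) ≤ −2λ̇_t k(t)` (`Ċ_s` is read at `s ∨ 0`).  No claim about Yang–Mills is made.
[cite: BauerschmidtBodineauDagallier2023, Theorem 3 (proof)] -/
theorem hasDerivAt_renormExpect_sqrtEnergy_le
    (hV : ContDiff ℝ 4 V₀) (hVB : ∀ n ≤ 4, ∀ x, ‖iteratedFDeriv ℝ n V₀ x‖ ≤ BV)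
    (hF : ContDiff ℝ 4 F) (hFB : ∀ n ≤ 4, ∀ x, ‖iteratedFDeriv ℝ n F x‖ ≤ BF)
    (ha : 0 < a) (hab : ∀ x, a ≤ F x ∧ F x ≤ b)
    {lamdot : ℝ → ℝ} (hMS : MultiscaleCondition D V₀ lamdot) {t : ℝ} (ht : 0 < t) :
    ∃ k' : ℝ,
      HasDerivAt (fun s => renormExpect D V₀ s fun y =>
        (1 / 4) * ((∑ k, ∑ l, D.Cdot (max s 0) k l *
          (fderiv ℝ (semigroup D V₀ 0 s F) y (EuclideanSpace.single k 1) *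
            fderiv ℝ (semigroup D V₀ 0 s F) y (EuclideanSpace.single l 1))) *
          (semigroup D V₀ 0 s F y)⁻¹)) k' t ∧
      k' ≤ -2 * lamdot t * renormExpect D V₀ t (fun y =>
        (1 / 4) * ((∑ k, ∑ l, D.Cdot (max t 0) k l *
          (fderiv ℝ (semigroup D V₀ 0 t F) y (EuclideanSpace.single k 1) *
            fderiv ℝ (semigroup D V₀ 0 t F) y (EuclideanSpace.single l 1))) *
          (semigroup D V₀ 0 t F y)⁻¹)) := by
  classical
  ---------------------------------------------------------------- data
  obtain ⟨hΨZ, hBZ⟩ := Cb4.exp_neg hV hVB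
  obtain ⟨hΨW, hBW⟩ := Cb4.mul hΨZ hF hBZ hFB
  have hVc : Continuous V₀ := hV.continuous
  have hFc : Continuous F := hF.continuous
  have hVabs : ∀ x, |V₀ x| ≤ BV := Cb4.abs_le hVB
  have hb : ∀ φ, -BV ≤ V₀ φ := fun φ => (abs_le.1 (hVabs φ)).1
  have hVm : Measurable V₀ := hVc.measurable
  have hG1 := Cb4.hasFDerivAt hΨZ
  have hG2 := Cb4.hasFDerivAt_fderiv hΨZ
  have hK1 := Cb4.norm_fderiv_le hBZ
  have hM2 := Cb4.norm_fderiv₂_le hBZ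
  have hUC2 := Cb4.uniformContinuous_fderiv₂ hΨZ hBZ
  have hmax : max t 0 = t := max_eq_left ht.le
  have hm : (0 : ℝ) < Real.exp (-BV) := Real.exp_pos _
  have hBZ0 : (0 : ℝ) ≤ 24 * Real.exp BV * max BV 1 ^ 4 := by positivity
  have hBF0 : 0 ≤ BF := le_trans (norm_nonneg _) (hFB 0 (by norm_num) 0)
  have hBW0 : (0 : ℝ) ≤ 16 * (24 * Real.exp BV * max BV 1 ^ 4) * BF := by positivity
  obtain ⟨KC, hKC⟩ := D.bounded_Cdot
  ---------------------------------------------------------------- atoms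
  have pZ := fun s => sm_pack hΨZ hBZ (multivariateGaussian 0 (D.C s))
  have pW := fun s => sm_pack hΨW hBW (multivariateGaussian 0 (D.C s))
  have pZ1 := fun k s => partial_pack_single hΨZ hBZ (multivariateGaussian 0 (D.C s)) k
  have pW1 := fun k s => partial_pack_single hΨW hBW (multivariateGaussian 0 (D.C s)) k
  have hZ1 := fun s k x =>
    sm_fderiv_apply hΨZ hBZ (multivariateGaussian 0 (D.C s)) x (EuclideanSpace.single k 1)
  have hW1 := fun s k x =>
    sm_fderiv_apply hΨW hBW (multivariateGaussian 0 (D.C s)) x (EuclideanSpace.single k 1)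
  have hZ2 : ∀ s (i j : Fin N) x,
      (∫ ζ, fderiv ℝ (fderiv ℝ (fun x => Real.exp (-V₀ x))) (x + ζ) ∂(multivariateGaussian 0 (D.C s)))
        (EuclideanSpace.single i 1) (EuclideanSpace.single j 1) =
      (∫ ζ, fderiv ℝ (fderiv ℝ (fun x => Real.exp (-V₀ x))) (x + ζ) (EuclideanSpace.single j 1)
        ∂(multivariateGaussian 0 (D.C s))) (EuclideanSpace.single i 1) := fun s i j x => by
    rw [sm_fderiv₂_apply hΨZ hBZ, sm_partial_fderiv_apply hΨZ hBZ, sm_fderiv₂_symm hΨZ]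
  have hW2 : ∀ s (i j : Fin N) x,
      (∫ ζ, fderiv ℝ (fderiv ℝ (fun x => Real.exp (-V₀ x) * F x)) (x + ζ)
        ∂(multivariateGaussian 0 (D.C s))) (EuclideanSpace.single i 1) (EuclideanSpace.single j 1) =
      (∫ ζ, fderiv ℝ (fderiv ℝ (fun x => Real.exp (-V₀ x) * F x)) (x + ζ) (EuclideanSpace.single j 1)
        ∂(multivariateGaussian 0 (D.C s))) (EuclideanSpace.single i 1) := fun s i j x => by
    rw [sm_fderiv₂_apply hΨW hBW, sm_partial_fderiv_apply hΨW hBW, sm_fderiv₂_symm hΨW]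
  have hZ2s : ∀ s (i j : Fin N) x,
      (∫ ζ, fderiv ℝ (fderiv ℝ (fun x => Real.exp (-V₀ x))) (x + ζ) (EuclideanSpace.single j 1)
        ∂(multivariateGaussian 0 (D.C s))) (EuclideanSpace.single i 1) =
      (∫ ζ, fderiv ℝ (fderiv ℝ (fun x => Real.exp (-V₀ x))) (x + ζ) (EuclideanSpace.single i 1)
        ∂(multivariateGaussian 0 (D.C s))) (EuclideanSpace.single j 1) := fun s i j x => by
    rw [sm_partial_fderiv_apply hΨZ hBZ, sm_partial_fderiv_apply hΨZ hBZ, sm_fderiv₂_symm hΨZ]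
  have hW2s : ∀ s (i j : Fin N) x,
      (∫ ζ, fderiv ℝ (fderiv ℝ (fun x => Real.exp (-V₀ x) * F x)) (x + ζ) (EuclideanSpace.single j 1)
        ∂(multivariateGaussian 0 (D.C s))) (EuclideanSpace.single i 1) =
      (∫ ζ, fderiv ℝ (fderiv ℝ (fun x => Real.exp (-V₀ x) * F x)) (x + ζ) (EuclideanSpace.single i 1)
        ∂(multivariateGaussian 0 (D.C s))) (EuclideanSpace.single j 1) := fun s i j x => by
    rw [sm_partial_fderiv_apply hΨW hBW, sm_partial_fderiv_apply hΨW hBW, sm_fderiv₂_symm hΨW]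
  -- lower bounds, the quotient `u_s = P_{0,s}F = W_s/Z_s`
  have hmZ : ∀ s y, Real.exp (-BV) ≤
      ∫ ζ, Real.exp (-V₀ (y + ζ)) ∂(multivariateGaussian 0 (D.C s)) :=
    fun s y => exp_neg_le_integral_exp_neg hVc hVabs _ y
  have haW : ∀ s y, a * (∫ ζ, Real.exp (-V₀ (y + ζ)) ∂(multivariateGaussian 0 (D.C s))) ≤
      ∫ ζ, Real.exp (-V₀ (y + ζ)) * F (y + ζ) ∂(multivariateGaussian 0 (D.C s)) :=
    fun s y => (integral_exp_neg_mul_mem hVc hVabs hFc hab _ y).1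
  have hsemi : ∀ s y, semigroup D V₀ 0 s F y =
      (∫ ζ, Real.exp (-V₀ (y + ζ)) * F (y + ζ) ∂(multivariateGaussian 0 (D.C s))) *
        (∫ ζ, Real.exp (-V₀ (y + ζ)) ∂(multivariateGaussian 0 (D.C s)))⁻¹ := fun s y => by
    rw [semigroup_zero_eq, exp_renormPotential_eq_inv D hVm hb, mul_comm]
  ---------------------------------------------------------------- the families
  set Cf : ℝ → Matrix (Fin N) (Fin N) ℝ := fun s => D.Cdot (max s 0) with hCf_def
  set gf : Fin N → ℝ → EuclideanSpace ℝ (Fin N) → ℝ :=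
    fun k s y => fderiv ℝ (semigroup D V₀ 0 s F) y (EuclideanSpace.single k 1) with hgf_def
  set Af : ℝ → EuclideanSpace ℝ (Fin N) → ℝ :=
    fun s y => ∑ k, ∑ l, Cf s k l * (gf k s y * gf l s y) with hAf_def
  set Gf : ℝ → EuclideanSpace ℝ (Fin N) → ℝ :=
    fun s y => (1 / 4) * (Af s y * (semigroup D V₀ 0 s F y)⁻¹) with hGf_def
  have hgf : ∀ k s y, gf k s y =
      (∫ ζ, fderiv ℝ (fun x => Real.exp (-V₀ x) * F x) (y + ζ) (EuclideanSpace.single k 1)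
          ∂(multivariateGaussian 0 (D.C s))) *
        (∫ ζ, Real.exp (-V₀ (y + ζ)) ∂(multivariateGaussian 0 (D.C s)))⁻¹ -
      (∫ ζ, Real.exp (-V₀ (y + ζ)) * F (y + ζ) ∂(multivariateGaussian 0 (D.C s))) *
        ((∫ ζ, fderiv ℝ (fun x => Real.exp (-V₀ x)) (y + ζ) (EuclideanSpace.single k 1)
            ∂(multivariateGaussian 0 (D.C s))) *
          ((∫ ζ, Real.exp (-V₀ (y + ζ)) ∂(multivariateGaussian 0 (D.C s)))⁻¹ *
            (∫ ζ, Real.exp (-V₀ (y + ζ)) ∂(multivariateGaussian 0 (D.C s)))⁻¹)) := by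
    intro k s y
    obtain ⟨Du, D2u, K1u, K2u, pu, hDu, -⟩ :=
      quotient_jets (pZ s) (pW s) hm (hmZ s) (semigroup D V₀ 0 s F) (hsemi s)
    show fderiv ℝ (semigroup D V₀ 0 s F) y (EuclideanSpace.single k 1) = _
    rw [(pu.1 y).fderiv, hDu, hZ1 s, hW1 s]
    ring
  -- bound on `Ċ_{s∨0}` and its derivative at `t`
  have bC : ∀ s k l, |Cf s k l| ≤ KC := fun s k l => hKC (max s 0) (le_max_right _ _) k l
  have sC : ∀ k l, HasDerivAt (fun s => Cf s k l) (D.Cddot t k l) t := fun k l => by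
    refine (D.hasDerivAt_Cdot t ht.le k l).congr_of_eventuallyEq ?_
    filter_upwards [lt_mem_nhds ht] with s hs
    simp only [hCf_def, max_eq_left hs.le]
  have hCs : ∀ k l, Cf t l k = Cf t k l := fun k l => D.Cdot_symm (le_max_right t 0) k l
  have hCpsd : (Cf t).PosSemidef := D.posSemidef_Cdot (max t 0) (le_max_right _ _)
  ---------------------------------------------------------------- slopes of the atoms at `t`
  have sZ := sm_uniformSlope D hΨZ hBZ ht
  have sW := sm_uniformSlope D hΨW hBW ht
  have sZ1 := fun k => sm_partial_uniformSlope D hΨZ hBZ (EuclideanSpace.single k 1) ht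
  have sW1 := fun k => sm_partial_uniformSlope D hΨW hBW (EuclideanSpace.single k 1) ht
  -- regularity of the four slope functions
  have rZd := uc_bdd_lincomb (D.Cdot t)
    (fun i j => (sm_scalar₂ hΨZ hBZ (multivariateGaussian 0 (D.C t))
      (EuclideanSpace.single i 1) (EuclideanSpace.single j 1)).2.2)
    (fun i j y => by
      have h := (sm_scalar₂ hΨZ hBZ (multivariateGaussian 0 (D.C t))
        (EuclideanSpace.single i 1) (EuclideanSpace.single j 1)).2.1 y
      simpa only [Cb4.norm_single_one, mul_one] using h)
  have rWd := uc_bdd_lincomb (D.Cdot t)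
    (fun i j => (sm_scalar₂ hΨW hBW (multivariateGaussian 0 (D.C t))
      (EuclideanSpace.single i 1) (EuclideanSpace.single j 1)).2.2)
    (fun i j y => by
      have h := (sm_scalar₂ hΨW hBW (multivariateGaussian 0 (D.C t))
        (EuclideanSpace.single i 1) (EuclideanSpace.single j 1)).2.1 y
      simpa only [Cb4.norm_single_one, mul_one] using h)
  have rZ1d := fun k => uc_bdd_lincomb (D.Cdot t)
    (fun i j => (sm_scalar₃ hΨZ hBZ (multivariateGaussian 0 (D.C t)) (EuclideanSpace.single k 1)
      (EuclideanSpace.single i 1) (EuclideanSpace.single j 1)).2.2)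
    (fun i j y => by
      have h := (sm_scalar₃ hΨZ hBZ (multivariateGaussian 0 (D.C t)) (EuclideanSpace.single k 1)
        (EuclideanSpace.single i 1) (EuclideanSpace.single j 1)).2.1 y
      simpa only [Cb4.norm_single_one, mul_one] using h)
  have rW1d := fun k => uc_bdd_lincomb (D.Cdot t)
    (fun i j => (sm_scalar₃ hΨW hBW (multivariateGaussian 0 (D.C t)) (EuclideanSpace.single k 1)
      (EuclideanSpace.single i 1) (EuclideanSpace.single j 1)).2.2)
    (fun i j y => by
      have h := (sm_scalar₃ hΨW hBW (multivariateGaussian 0 (D.C t)) (EuclideanSpace.single k 1)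
        (EuclideanSpace.single i 1) (EuclideanSpace.single j 1)).2.1 y
      simpa only [Cb4.norm_single_one, mul_one] using h)
  set KD : ℝ := (1 / 2) * (∑ i, ∑ j, |D.Cdot t i j|) *
    (24 * Real.exp BV * max BV 1 ^ 4 + 16 * (24 * Real.exp BV * max BV 1 ^ 4) * BF) with hKD
  have hc0 : 0 ≤ (1 / 2) * (∑ i, ∑ j, |D.Cdot t i j|) := by positivity
  have hKDZ : (1 / 2) * (∑ i, ∑ j, |D.Cdot t i j|) * (24 * Real.exp BV * max BV 1 ^ 4) ≤ KD := by
    rw [hKD]; exact mul_le_mul_of_nonneg_left (le_add_of_nonneg_right hBW0) hc0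
  have hKDW : (1 / 2) * (∑ i, ∑ j, |D.Cdot t i j|) * (16 * (24 * Real.exp BV * max BV 1 ^ 4) * BF) ≤
      KD := by
    rw [hKD]; exact mul_le_mul_of_nonneg_left (le_add_of_nonneg_left hBZ0) hc0
  ---------------------------------------------------------------- derived slope functions
  set Zd : EuclideanSpace ℝ (Fin N) → ℝ := fun y => (1 / 2) * ∑ i, ∑ j, D.Cdot t i j *
    ∫ w, fderiv ℝ (fderiv ℝ (fun x => Real.exp (-V₀ x))) (y + w) (EuclideanSpace.single i 1)
      (EuclideanSpace.single j 1) ∂(multivariateGaussian 0 (D.C t)) with hZd_def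
  set Wd : EuclideanSpace ℝ (Fin N) → ℝ := fun y => (1 / 2) * ∑ i, ∑ j, D.Cdot t i j *
    ∫ w, fderiv ℝ (fderiv ℝ (fun x => Real.exp (-V₀ x) * F x)) (y + w) (EuclideanSpace.single i 1)
      (EuclideanSpace.single j 1) ∂(multivariateGaussian 0 (D.C t)) with hWd_def
  set Z1d : Fin N → EuclideanSpace ℝ (Fin N) → ℝ := fun k y => (1 / 2) * ∑ i, ∑ j, D.Cdot t i j *
    ∫ w, fderiv ℝ (fderiv ℝ (fderiv ℝ (fun x => Real.exp (-V₀ x)))) (y + w) (EuclideanSpace.single k 1)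
      (EuclideanSpace.single i 1) (EuclideanSpace.single j 1) ∂(multivariateGaussian 0 (D.C t))
    with hZ1d_def
  set W1d : Fin N → EuclideanSpace ℝ (Fin N) → ℝ := fun k y => (1 / 2) * ∑ i, ∑ j, D.Cdot t i j *
    ∫ w, fderiv ℝ (fderiv ℝ (fderiv ℝ (fun x => Real.exp (-V₀ x) * F x))) (y + w)
      (EuclideanSpace.single k 1) (EuclideanSpace.single i 1) (EuclideanSpace.single j 1)
      ∂(multivariateGaussian 0 (D.C t)) with hW1d_def
  set ud : EuclideanSpace ℝ (Fin N) → ℝ := fun y =>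
    Wd y / (∫ ζ, Real.exp (-V₀ (y + ζ)) ∂(multivariateGaussian 0 (D.C t))) -
      (∫ ζ, Real.exp (-V₀ (y + ζ)) * F (y + ζ) ∂(multivariateGaussian 0 (D.C t))) * Zd y /
        (∫ ζ, Real.exp (-V₀ (y + ζ)) ∂(multivariateGaussian 0 (D.C t))) ^ 2 with hud_def
  set gd : Fin N → EuclideanSpace ℝ (Fin N) → ℝ := fun k y =>
    W1d k y / (∫ ζ, Real.exp (-V₀ (y + ζ)) ∂(multivariateGaussian 0 (D.C t))) -
      (∫ ζ, fderiv ℝ (fun x => Real.exp (-V₀ x) * F x) (y + ζ) (EuclideanSpace.single k 1)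
          ∂(multivariateGaussian 0 (D.C t))) * Zd y /
        (∫ ζ, Real.exp (-V₀ (y + ζ)) ∂(multivariateGaussian 0 (D.C t))) ^ 2 -
      Wd y * (∫ ζ, fderiv ℝ (fun x => Real.exp (-V₀ x)) (y + ζ) (EuclideanSpace.single k 1)
          ∂(multivariateGaussian 0 (D.C t))) /
        (∫ ζ, Real.exp (-V₀ (y + ζ)) ∂(multivariateGaussian 0 (D.C t))) ^ 2 -
      (∫ ζ, Real.exp (-V₀ (y + ζ)) * F (y + ζ) ∂(multivariateGaussian 0 (D.C t))) * Z1d k y /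
        (∫ ζ, Real.exp (-V₀ (y + ζ)) ∂(multivariateGaussian 0 (D.C t))) ^ 2 +
      2 * (∫ ζ, Real.exp (-V₀ (y + ζ)) * F (y + ζ) ∂(multivariateGaussian 0 (D.C t))) *
        (∫ ζ, fderiv ℝ (fun x => Real.exp (-V₀ x)) (y + ζ) (EuclideanSpace.single k 1)
          ∂(multivariateGaussian 0 (D.C t))) * Zd y /
        (∫ ζ, Real.exp (-V₀ (y + ζ)) ∂(multivariateGaussian 0 (D.C t))) ^ 3 with hgd_def
  set Ad : EuclideanSpace ℝ (Fin N) → ℝ := fun y =>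
    2 * (∑ k, ∑ l, Cf t k l * (gd k y * gf l t y)) + ∑ k, ∑ l, D.Cddot t k l * (gf k t y * gf l t y)
    with hAd_def
  set Hd : EuclideanSpace ℝ (Fin N) → ℝ := fun y =>
    Ad y / (4 * semigroup D V₀ 0 t F y) - Af t y * ud y / (4 * semigroup D V₀ 0 t F y ^ 2)
    with hHd_def
  ---------------------------------------------------------------- Part B: the family
  obtain ⟨cG, ⟨KG, hKG⟩, sH, cHd, ⟨KHd, hKHd⟩, ucHd⟩ := sqrtGradient_family
    (Cf := Cf) (Cd := D.Cddot t) (t := t)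
    (fun s => continuous_iff_continuousAt.2 fun y => ((pZ s).1 y).continuousAt)
    (fun s => continuous_iff_continuousAt.2 fun y => ((pW s).1 y).continuousAt)
    (fun k s => continuous_iff_continuousAt.2 fun y => ((pZ1 k s).1 y).continuousAt)
    (fun k s => continuous_iff_continuousAt.2 fun y => ((pW1 k s).1 y).continuousAt)
    (fun s y => (pW s).2.2.1 y) (fun k s y => (pZ1 k s).2.2.1 y) (fun k s y => (pW1 k s).2.2.1 y)
    bC hm hmZ ha haW
    (sm_uniformContinuous hΨZ hBZ (multivariateGaussian 0 (D.C t))).1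
    (sm_uniformContinuous hΨW hBW (multivariateGaussian 0 (D.C t))).1
    (fun k => (sm_partial_uniformContinuous hΨZ hBZ (multivariateGaussian 0 (D.C t))
      (EuclideanSpace.single k 1)).1)
    (fun k => (sm_partial_uniformContinuous hΨW hBW (multivariateGaussian 0 (D.C t))
      (EuclideanSpace.single k 1)).1)
    (Zd := Zd) (Wd := Wd) (Z1d := Z1d) (W1d := W1d) sZ sW sZ1 sW1 sC hCs
    rZd.1 rWd.1 (fun k => (rZ1d k).1) (fun k => (rW1d k).1)
    (KD := KD) (fun y => (rZd.2 y).trans hKDZ) (fun y => (rWd.2 y).trans hKDW)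
    (fun k y => ((rZ1d k).2 y).trans hKDZ) (fun k y => ((rW1d k).2 y).trans hKDW)
    (fun s => semigroup D V₀ 0 s F) hsemi gf hgf Af (fun s y => rfl) Gf (fun s y => rfl)
    ud (fun y => rfl) gd (fun k y => rfl) Ad (fun y => rfl) Hd (fun y => rfl)
  ---------------------------------------------------------------- Part A: the pointwise inequality at `t`
  have hmsA : ∀ x, lamdot t * ((fun k => gf k t x) ⬝ᵥ (Cf t *ᵥ fun k => gf k t x)) ≤
      (Cf t *ᵥ fun k => gf k t x) ⬝ᵥ
          ((Matrix.of fun i k : Fin N =>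
            -((∫ ζ, fderiv ℝ (fderiv ℝ (fun x => Real.exp (-V₀ x))) (x + ζ) (EuclideanSpace.single i 1)
                ∂(multivariateGaussian 0 (D.C t))) (EuclideanSpace.single k 1)) /
                (∫ ζ, Real.exp (-V₀ (x + ζ)) ∂(multivariateGaussian 0 (D.C t))) +
              (∫ ζ, fderiv ℝ (fun x => Real.exp (-V₀ x)) (x + ζ) (EuclideanSpace.single i 1)
                ∂(multivariateGaussian 0 (D.C t))) *
                (∫ ζ, fderiv ℝ (fun x => Real.exp (-V₀ x)) (x + ζ) (EuclideanSpace.single k 1)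
                  ∂(multivariateGaussian 0 (D.C t))) /
                (∫ ζ, Real.exp (-V₀ (x + ζ)) ∂(multivariateGaussian 0 (D.C t))) ^ 2) *ᵥ
            (Cf t *ᵥ fun k => gf k t x)) -
        (1 / 2) * ((fun k => gf k t x) ⬝ᵥ (D.Cddot t *ᵥ fun k => gf k t x)) := by
    intro x
    have h := multiscale_jet D hG1 hG2 hb hK1 hM2 hUC2.continuous hMS ht x (fun k => gf k t x)
    simp only [hCf_def, hmax]
    simp only [sm_fderiv₂_apply hΨZ hBZ, sm_partial_fderiv_apply hΨZ hBZ, sm_fderiv_apply hΨZ hBZ]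
      at h ⊢
    exact h
  obtain ⟨DH, D2H, K0, K1, K2, pH, hineq⟩ := sqrtGradient_exchange
    (pZ t) (pW t) (fun k => pZ1 k t) (fun k => pW1 k t) (hZ1 t) (hW1 t) (hZ2 t) (hW2 t)
    (hZ2s t) (hW2s t) hm (hmZ t) ha (haW t) (C := Cf t) (Cdd := D.Cddot t) hCpsd hCs
    (lam := lamdot t) (semigroup D V₀ 0 t F) (hsemi t) (fun k => gf k t) (fun k => hgf k t)
    (Af t) (fun x => rfl) (Gf t) (fun x => rfl) Zd Wd Z1d W1d
    (fun x => by
      simp only [hZd_def, hCf_def, hmax]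
      refine congrArg _ (Finset.sum_congr rfl fun i _ => Finset.sum_congr rfl fun j _ => ?_)
      rw [sm_partial_fderiv_apply hΨZ hBZ, sm_fderiv₂_symm hΨZ])
    (fun x => by
      simp only [hWd_def, hCf_def, hmax]
      refine congrArg _ (Finset.sum_congr rfl fun i _ => Finset.sum_congr rfl fun j _ => ?_)
      rw [sm_partial_fderiv_apply hΨW hBW, sm_fderiv₂_symm hΨW])
    (fun k x => by
      simp only [hZ1d_def, hCf_def, hmax]
      refine congrArg _ (Finset.sum_congr rfl fun i _ => Finset.sum_congr rfl fun j _ => ?_)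
      rw [sm_partial_fderiv₂_apply hΨZ hBZ])
    (fun k x => by
      simp only [hW1d_def, hCf_def, hmax]
      refine congrArg _ (Finset.sum_congr rfl fun i _ => Finset.sum_congr rfl fun j _ => ?_)
      rw [sm_partial_fderiv₂_apply hΨW hBW])
    ud (fun x => rfl) gd (fun k x => rfl) Ad (fun x => rfl) Hd (fun x => rfl) hmsA
  ---------------------------------------------------------------- the dual family identity
  have hder := hasDerivAt_renormExpect_family D hG1 hG2 hb hK1 hM2 hUC2 ht (G := Gf) (Gd := Hd)
    pH.1 pH.2.1 cG hKG pH.2.2.2.1 pH.2.2.2.2.1 pH.2.2.2.2.2 cHd hKHd ucHd sH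
  refine ⟨_, hder, ?_⟩
  ---------------------------------------------------------------- the inequality of the values
  have hZne : ∀ y, (∫ ζ, Real.exp (-V₀ (y + ζ)) ∂(multivariateGaussian 0 (D.C t))) ≠ 0 :=
    fun y => (hm.trans_le (hmZ t y)).ne'
  -- the integrand of the derivative equals the right-hand side of the pointwise inequality
  have hpt : ∀ y, 2 * lamdot t * Gf t y ≤
      (1 / 2) * ∑ i, ∑ j, D.Cdot t i j * D2H y (EuclideanSpace.single i 1) (EuclideanSpace.single j 1) -
        ∑ i, ∑ j, D.Cdot t i j *
          (-((∫ ζ, Real.exp (-V₀ (y + ζ)) ∂(multivariateGaussian 0 (D.C t)))⁻¹ •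
              ∫ ζ, fderiv ℝ (fun x => Real.exp (-V₀ x)) (y + ζ) ∂(multivariateGaussian 0 (D.C t))))
            (EuclideanSpace.single i 1) * DH y (EuclideanSpace.single j 1) - Hd y := by
    intro y
    refine (hineq y).trans_eq ?_
    simp only [hCf_def, hmax]
    congr 2
    refine Finset.sum_congr rfl fun i _ => Finset.sum_congr rfl fun j _ => ?_
    rw [_root_.neg_apply, _root_.smul_apply, smul_eq_mul, hZ1 t]
    ring
  -- continuity and bounds of both sides
  have cGt : Continuous (fun y => 2 * lamdot t * Gf t y) := continuous_const.mul (cG t)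
  have bGt : ∃ K, ∀ y, |2 * lamdot t * Gf t y| ≤ K :=
    bd_mul (f := fun _ => 2 * lamdot t) ⟨_, fun _ => le_rfl⟩ ⟨KG, hKG t⟩
  have cDH : Continuous DH := continuous_iff_continuousAt.2 fun y => (pH.2.1 y).continuousAt
  have cD2H : Continuous D2H := pH.2.2.2.2.2.continuous
  have cZ1t : ∀ i, Continuous fun y => ∫ ζ, fderiv ℝ (fun x => Real.exp (-V₀ x)) (y + ζ)
      (EuclideanSpace.single i 1) ∂(multivariateGaussian 0 (D.C t)) :=
    fun i => continuous_iff_continuousAt.2 fun y => ((pZ1 i t).1 y).continuousAt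
  have cZt : Continuous fun y => ∫ ζ, Real.exp (-V₀ (y + ζ)) ∂(multivariateGaussian 0 (D.C t)) :=
    continuous_iff_continuousAt.2 fun y => ((pZ t).1 y).continuousAt
  have hpfun : ∀ i : Fin N, (fun y => (-((∫ ζ, Real.exp (-V₀ (y + ζ)) ∂(multivariateGaussian 0 (D.C t)))⁻¹ •
        ∫ ζ, fderiv ℝ (fun x => Real.exp (-V₀ x)) (y + ζ) ∂(multivariateGaussian 0 (D.C t))))
        (EuclideanSpace.single i 1)) =
      fun y => -((∫ ζ, Real.exp (-V₀ (y + ζ)) ∂(multivariateGaussian 0 (D.C t)))⁻¹ *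
        ∫ ζ, fderiv ℝ (fun x => Real.exp (-V₀ x)) (y + ζ) (EuclideanSpace.single i 1)
          ∂(multivariateGaussian 0 (D.C t))) := fun i => by
    funext y
    rw [_root_.neg_apply, _root_.smul_apply, smul_eq_mul, hZ1 t]
  have cP : ∀ i : Fin N, Continuous fun y =>
      (-((∫ ζ, Real.exp (-V₀ (y + ζ)) ∂(multivariateGaussian 0 (D.C t)))⁻¹ •
        ∫ ζ, fderiv ℝ (fun x => Real.exp (-V₀ x)) (y + ζ) ∂(multivariateGaussian 0 (D.C t))))
        (EuclideanSpace.single i 1) := fun i => by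
    rw [hpfun i]
    exact ((cZt.inv₀ hZne).mul (cZ1t i)).neg
  have bP : ∀ i : Fin N, ∃ K, ∀ y,
      |(-((∫ ζ, Real.exp (-V₀ (y + ζ)) ∂(multivariateGaussian 0 (D.C t)))⁻¹ •
        ∫ ζ, fderiv ℝ (fun x => Real.exp (-V₀ x)) (y + ζ) ∂(multivariateGaussian 0 (D.C t))))
        (EuclideanSpace.single i 1)| ≤ K := fun i => by
    refine ⟨(Real.exp (-BV))⁻¹ * (24 * Real.exp BV * max BV 1 ^ 4), fun y => ?_⟩
    rw [_root_.neg_apply, _root_.smul_apply, smul_eq_mul, hZ1 t]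
    rw [abs_neg, abs_mul, abs_inv, abs_of_pos (hm.trans_le (hmZ t y))]
    exact mul_le_mul (inv_anti₀ hm (hmZ t y)) ((pZ1 i t).2.2.1 y) (abs_nonneg _) (by positivity)
  have cD2He : ∀ i j : Fin N, Continuous fun y =>
      D2H y (EuclideanSpace.single i 1) (EuclideanSpace.single j 1) := fun i j =>
    ((ContinuousLinearMap.apply ℝ ℝ (EuclideanSpace.single j 1)).comp
      (ContinuousLinearMap.apply ℝ (EuclideanSpace ℝ (Fin N) →L[ℝ] ℝ)
        (EuclideanSpace.single i 1))).continuous.comp cD2H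
  have bD2He : ∀ i j : Fin N, ∃ K, ∀ y, |D2H y (EuclideanSpace.single i 1) (EuclideanSpace.single j 1)| ≤ K :=
    fun i j => ⟨K2, fun y => by
      rw [← Real.norm_eq_abs]
      refine (ContinuousLinearMap.le_opNorm _ _).trans ?_
      rw [Cb4.norm_single_one, mul_one]
      refine (ContinuousLinearMap.le_opNorm _ _).trans ?_
      rw [Cb4.norm_single_one, mul_one]
      exact pH.2.2.2.2.1 y⟩
  have cDHe : ∀ j : Fin N, Continuous fun y => DH y (EuclideanSpace.single j 1) := fun j =>
    (ContinuousLinearMap.apply ℝ ℝ (EuclideanSpace.single j 1)).continuous.comp cDH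
  have bDHe : ∀ j : Fin N, ∃ K, ∀ y, |DH y (EuclideanSpace.single j 1)| ≤ K := fun j =>
    ⟨K1, fun y => by
      rw [← Real.norm_eq_abs]
      refine (ContinuousLinearMap.le_opNorm _ _).trans ?_
      rw [Cb4.norm_single_one, mul_one]
      exact pH.2.2.2.1 y⟩
  have cL : Continuous fun y =>
      (1 / 2) * ∑ i, ∑ j, D.Cdot t i j * D2H y (EuclideanSpace.single i 1) (EuclideanSpace.single j 1) -
        ∑ i, ∑ j, D.Cdot t i j *
          (-((∫ ζ, Real.exp (-V₀ (y + ζ)) ∂(multivariateGaussian 0 (D.C t)))⁻¹ •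
              ∫ ζ, fderiv ℝ (fun x => Real.exp (-V₀ x)) (y + ζ) ∂(multivariateGaussian 0 (D.C t))))
            (EuclideanSpace.single i 1) * DH y (EuclideanSpace.single j 1) - Hd y := by
    refine Continuous.sub (Continuous.sub (continuous_const.mul
      (continuous_finsetSum _ fun i _ => continuous_finsetSum _ fun j _ =>
        continuous_const.mul (cD2He i j)))
      (continuous_finsetSum _ fun i _ => continuous_finsetSum _ fun j _ =>
        (continuous_const.mul (cP i)).mul (cDHe j))) cHd
  have bL : ∃ K, ∀ y,
      |(1 / 2) * ∑ i, ∑ j, D.Cdot t i j * D2H y (EuclideanSpace.single i 1) (EuclideanSpace.single j 1) -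
        ∑ i, ∑ j, D.Cdot t i j *
          (-((∫ ζ, Real.exp (-V₀ (y + ζ)) ∂(multivariateGaussian 0 (D.C t)))⁻¹ •
              ∫ ζ, fderiv ℝ (fun x => Real.exp (-V₀ x)) (y + ζ) ∂(multivariateGaussian 0 (D.C t))))
            (EuclideanSpace.single i 1) * DH y (EuclideanSpace.single j 1) - Hd y| ≤ K := by
    refine bd_sub (bd_sub (bd_mul ⟨_, fun _ => le_rfl⟩
      (bd_sum Finset.univ fun i _ => bd_sum Finset.univ fun j _ =>
        bd_mul ⟨_, fun _ => le_rfl⟩ (bD2He i j)))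
      (bd_sum Finset.univ fun i _ => bd_sum Finset.univ fun j _ =>
        bd_mul (bd_mul ⟨_, fun _ => le_rfl⟩ (bP i)) (bDHe j))) ⟨KHd, hKHd⟩
  have hmono := renormExpect_mono D hVm hb t cGt cL bGt bL hpt
  rw [renormExpect_const_mul] at hmono
  linarith

end Exchange

end Polchinski

end Literature.Analysis.FunctionSpaces

end
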